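import Summits.CriticalPhenomena.Ising3DConformalLimit.Theses.ModularQuarterTurn
import Summits.CriticalPhenomena.Ising3DConformalLimit.Theorems.HyperoctahedralRPLimitRotationInvariant
import Summits.CriticalPhenomena.Ising3DConformalLimit.Theorems.HyperoctahedralRPHRP2Rigidity
import Summits.CriticalPhenomena.Ising3DConformalLimit.Theorems.ModularQuarterTurnToroidalInversionUpgrade
import Summits.CriticalPhenomena.Ising3DConformalLimit.Theorems.ModularQuarterTurnAxialRotationUpgrade
import HarnessLib

/-!
# REDIRECT r1 certificate for crux `WedgeModularRotation` (stmt-CriticalPhenomena-6493) — published as `Cruxes/WedgeModularRotation/REDIRECT-r1.lean`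

Strategist `planner-cstrat-stmt-CriticalPhenomena-6493-r1-0`, 2026-08-17.

FACT (tree, 2026-08-16): items stmt-1979 `HRP2Rigidity` and stmt-1980 `LimitRotationInvariant` of route
`HyperoctahedralRP` are PROVED (`HRP2Rigidity.XRayMellin.HRP2Rigidity_of`,
`LimitRotationInvariant.QuarterTurnLiouville.limitRotationInvariant_proof`). Their composition `rotInv_all` is
"every normalised, non-degenerate, translation-invariant, scale-covariant pointwise scaling limit of
`criticalCorr 3` is `O(3)`-invariant" — with EXACTLY the hypotheses the deciding theorem `closes` of route
`ModularQuarterTurn` has in hand after destructuring `ExistsScaleCovariantLimit`.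

CONSEQUENCES checked below (no `sorry`):
* `closes_without_WedgeModularRotation` — the sub-problem from `BallModularMoebius`, `ExistsScaleCovariantLimit`,
  `IsingEuclidUpgradeR4NonGaussian`, `ToroidalInversionUpgrade` ONLY: the crux `WedgeModularRotation` (and the
  support `AxialRotationUpgrade`) are NOT needed by the route's deciding theorem any more;
* `closes_three_binders` — with the landed `toroidalInversionUpgrade_proof` (item 6497) the deciding theorem needs
  exactly the three open items BallModularMoebius (a line on hub 1982), ExistsScaleCovariantLimit (hub 1981),
  IsingEuclidUpgradeR4NonGaussian (hub 0636);
* `axialIsotropy_of_tree` — the registered stub `stub_axialIsotropy` (A) of `Cruxes/WedgeModularRotation/Lines/birth.lean`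
  is a corollary of the tree, so `WedgeModularRotation` ⟺ its lattice content (E ∧ I: convergence of the fractional
  corner-transfer words and identification of their limit), which no deciding theorem consumes.
-/

noncomputable section

open Literature.Probability.LatticeModels
open Literature.MathematicalPhysics.QuantumFieldTheory (planeRot)
open Summit.CriticalPhenomena.Ising3DConformalLimit.Theses.ModularQuarterTurn

namespace Summit.CriticalPhenomena.Ising3DConformalLimit.Cruxes.WedgeModularRotation.RedirectR1

/-- **RotInv∀ is a theorem of the tree** (items 1980 ∘ 1979). -/
theorem rotInv_all : ∀ (ρ : ℝ → ℝ) (Δ : ℝ) (S : CorrFamily 3), (∀ δ ∈ Set.Ioc (0:ℝ) 1, 0 < ρ δ) →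
    HasPointwiseScalingLimit (criticalCorr 3) ρ S → (∀ n z, z ∉ NonCoincident 3 n → S n z = 0) →
    IsNondegenerateTwoPoint S → IsTranslationInvariant S → IsScaleCovariant Δ S → IsRotationInvariant S :=
  Cruxes.LimitRotationInvariant.QuarterTurnLiouville.limitRotationInvariant_proof
    Cruxes.HRP2Rigidity.XRayMellin.HRP2Rigidity_of

/-- **The deciding theorem of route ModularQuarterTurn WITHOUT the crux `WedgeModularRotation`.**
Same proof as the route's `closes`, with `hrot` supplied by the tree instead of by
`WedgeModularRotation` + `AxialRotationUpgrade`. -/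
theorem closes_without_WedgeModularRotation (h_BallModularMoebius : BallModularMoebius)
    (h_ExistsScaleCovariantLimit : ExistsScaleCovariantLimit)
    (h_IsingEuclidUpgradeR4NonGaussian : IsingEuclidUpgradeR4NonGaussian)
    (h_ToroidalInversionUpgrade : ToroidalInversionUpgrade) : _root_.Ising3DConformalLimit := by
  obtain ⟨ρ, Δ, S, hρ, hΔ, hlim, hnorm, hnd, htr, hsc⟩ := h_ExistsScaleCovariantLimit
  have hrot : IsRotationInvariant S := rotInv_all ρ Δ S hρ hlim hnorm hnd htr hsc
  have heuc : IsEuclideanInvariant S := ⟨htr, hrot⟩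
  have hinv : IsInversionCovariant Δ S := by
    refine h_ToroidalInversionUpgrade ρ Δ S hρ hΔ hlim hnorm hnd heuc hsc ?_
    intro r hr n c c' p hcp
    obtain ⟨L, hL⟩ := h_BallModularMoebius ρ Δ S hρ hΔ hlim hnorm hnd heuc hsc r hr
    have hc'p := hcp
    exact tendsto_nhds_unique ((hL n).tendsto_at hcp) ((hL n).tendsto_at (a := (c', p)) hc'p)
  exact ⟨ρ, Δ, S, hρ, hΔ, hlim, hnd, ⟨heuc, hsc, hinv⟩, h_IsingEuclidUpgradeR4NonGaussian ρ S hρ hlim hnd⟩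

/-- **Three binders suffice**: `ToroidalInversionUpgrade` is the landed item 6497. -/
theorem closes_three_binders (h_BallModularMoebius : BallModularMoebius)
    (h_ExistsScaleCovariantLimit : ExistsScaleCovariantLimit)
    (h_IsingEuclidUpgradeR4NonGaussian : IsingEuclidUpgradeR4NonGaussian) : _root_.Ising3DConformalLimit :=
  closes_without_WedgeModularRotation h_BallModularMoebius h_ExistsScaleCovariantLimit
    h_IsingEuclidUpgradeR4NonGaussian
    Summit.CriticalPhenomena.Ising3DConformalLimit.ModularQuarterTurnToroidal.toroidalInversionUpgrade_proof

/-- **Stub A of the birth skeleton is a corollary of the tree.**  Verbatim the registered signature of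
`stub_axialIsotropy` (`Cruxes/WedgeModularRotation/Lines/birth.lean`): axial isotropy of every admissible limit on
the wedge domain, from `rotInv_all` with `R = planeRot 0 c` (rotation of the horizontal polar angle by `-c`). -/
theorem axialIsotropy_of_tree :
    ∀ (ρ : ℝ → ℝ) (Δ : ℝ) (S : CorrFamily 3), (∀ δ ∈ Set.Ioc (0:ℝ) 1, 0 < ρ δ) → 0 < Δ → HasPointwiseScalingLimit (criticalCorr 3) ρ S → (∀ n z, z ∉ NonCoincident 3 n → S n z = 0) → IsNondegenerateTwoPoint S → IsTranslationInvariant S → IsScaleCovariant Δ S → ∀ (n : ℕ) (c : ℝ) (p : Fin n → ℝ × ℝ × ℝ), p ∈ {p' : Fin n → ℝ × ℝ × ℝ | (∀ i, 0 ≤ (p' i).1 ∧ 0 < (p' i).2.1) ∧ ∑ i, (p' i).1 = 2 * Real.pi ∧ (fun i : Fin n => (!₂[(p' i).2.1 * Real.cos (∑ j : Fin n, if j < i then (p' j).1 else 0), (p' i).2.1 * Real.sin (∑ j : Fin n, if j < i then (p' j).1 else 0), (p' i).2.2] : EuclideanSpace ℝ (Fin 3))) ∈ NonCoincident 3 n}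 → S n (fun i : Fin n => (!₂[(p i).2.1 * Real.cos (c + ∑ j : Fin n, if j < i then (p j).1 else 0), (p i).2.1 * Real.sin (c + ∑ j : Fin n, if j < i then (p j).1 else 0), (p i).2.2] : EuclideanSpace ℝ (Fin 3))) = S n (fun i : Fin n => (!₂[(p i).2.1 * Real.cos (∑ j : Fin n, if j < i then (p j).1 else 0), (p i).2.1 * Real.sin (∑ j : Fin n, if j < i then (p j).1 else 0), (p i).2.2] : EuclideanSpace ℝ (Fin 3))) := by
  intro ρ Δ S hρ _hΔ hlim hnorm hnd htr hsc n c p _hp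
  have hrot : IsRotationInvariant S := rotInv_all ρ Δ S hρ hlim hnorm hnd htr hsc
  -- rotate the offset-`c` configuration by `-c` about the `x₂`-axis
  have key := hrot n (planeRot (d := 2) 0 c)
    (fun i : Fin n => (!₂[(p i).2.1 * Real.cos (c + ∑ j : Fin n, if j < i then (p j).1 else 0), (p i).2.1 * Real.sin (c + ∑ j : Fin n, if j < i then (p j).1 else 0), (p i).2.2] : EuclideanSpace ℝ (Fin 3)))
  have hcfg : (fun i : Fin n => planeRot (d := 2) 0 c
      ((!₂[(p i).2.1 * Real.cos (c + ∑ j : Fin n, if j < i then (p j).1 else 0), (p i).2.1 * Real.sin (c + ∑ j : Fin n, if j < i then (p j).1 else 0), (p i).2.2] : EuclideanSpace ℝ (Fin 3)))) =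
      (fun i : Fin n => (!₂[(p i).2.1 * Real.cos (∑ j : Fin n, if j < i then (p j).1 else 0), (p i).2.1 * Real.sin (∑ j : Fin n, if j < i then (p j).1 else 0), (p i).2.2] : EuclideanSpace ℝ (Fin 3))) := by
    funext i
    rw [Summit.CriticalPhenomena.Ising3DConformalLimit.ModularQuarterTurnAxial.planeRot_zero_polar c (p i).2.1
      (c + ∑ j : Fin n, if j < i then (p j).1 else 0) _ (by simp) (by simp)]
    simp [add_sub_cancel_left]
  rw [hcfg] at key
  exact key.symm

end Summit.CriticalPhenomena.Ising3DConformalLimit.Cruxes.WedgeModularRotation.RedirectR1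

end

#print axioms Summit.CriticalPhenomena.Ising3DConformalLimit.Cruxes.WedgeModularRotation.RedirectR1.rotInv_all
#print axioms Summit.CriticalPhenomena.Ising3DConformalLimit.Cruxes.WedgeModularRotation.RedirectR1.closes_without_WedgeModularRotation
#print axioms Summit.CriticalPhenomena.Ising3DConformalLimit.Cruxes.WedgeModularRotation.RedirectR1.closes_three_binders
#print axioms Summit.CriticalPhenomena.Ising3DConformalLimit.Cruxes.WedgeModularRotation.RedirectR1.axialIsotropy_of_tree
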